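import Summits.Schanuel.Schanuel.Theorems.RootDecomp1BAlgFrame08

/-!
# RootDecomp1BAlgFrame — lens 4, generation 40 «UNBOUNDED-DEGREE FRAMES» (lane B-R24 (b′), PRICE B-β, RULE B-R26): X(2) and the three At-cells at (1 | ρ) for every ρ in the class `AlgUltraLiouville` (doubly-exponential hyper-approximation by real algebraic irrationals of UNBOUNDED degree) modulo `Roy2014_thm_1_1` ONLY — the degree a running parameter of Roy's point-explicit L–W measure (budget lemma `algFrameMeasure_explicit_of_roy` with the floor exp(−royC D·exp(A^8)·(1+log H)) in its TYPE); the NAMED MEMBER ρ_A (a tower over 2^{1/p}, prime degrees p → ∞) with HYPOTHESIS-FREE membership, degree certificate [ℚ(β_K):ℚ] = g_K, position certificate |ρ_A − γ| ≥ exp(−A⁴) and the exclusions BY TREE NAMES (¬Hyper, ¬QuadHyper, ¬Ultra ×2, ¬LiouvilleOrder 8, transcendental) — continuation (RootDecomp1BAlgFrame09): §C cells, member cells, rhoA_position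

(lens-4 g40 HOME kernel AlgFrame.lean fe3f4606…, 1974 l, imports tree RootDecomp1BQuadFrame05 + RootDecomp1EPointTransfer04 only; CLAIM L2078, RULING + CHECKLIST B-g40 L2080, NODE L2101 / REQUEST L2102 / RESULT L2103, critic VERDICT L2111 (crit g9: (A) CLEARED — ONE CELL (B-β); lens-4 tally THEOREM ×6 + CELL ×3; RULE B-R26 in force (the Roy-transfer line on 1B CLOSED); PORT GO 01–09 `--supports stmt-Schanuel-24622`); port by census-1 gen 18 as `RootDecomp1BAlgFrame01`–`09` along K's sections: 01 = §D the class `AlgUltraLiouville` + the measure shape `AlgFrameMeasure` + §R helpers (`royC`); 02 = §R the budget lemma `algFrameMeasure_explicit_of_roy` (Roy ⟹ the algebraic frame measure in EVERY degree; scoped `maxHeartbeats 1600000` carried as in K); 03 = §E the engine `algebraicIndependent_exp_frame_of_algUltraLiouville (hRoy)` + the `![…]` forms; 04 = §M.1–§M.3 prime degrees `gdeg`, radicals `theta`, frame data `Nseq`/`Pseq`/`fd` (with `attribute [irreducible] fd`), `betaSeq`, `fSeq`, `ASeq`, growth; 05 = §M.4–§M.5 increments, the limit `rhoA`, MEMBERSHIP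 `algUltraLiouville_rhoA`; 06 = §M.6–§M.7 degree certificate `finrank_adjoin_theta` / `adjoin_betaSeq_eq` + the number-field Liouville inequality (`FK`, `thetaF`, `sigma0`, norm to ℚ); 07 = §M.8–§M.9 the frame bound, the tower inequality, scale selection, `cert_arith`; 08 = §M.10–§M.11 THE POSITION CERTIFICATE `rhoA_far_from_degree_le` + EXCLUSIONS by tree names (`not_hyperLiouville_rhoA`, `not_quadHyperLiouville_rhoA`, `not_ultraLiouville_rhoA` / `'`, `not_liouvilleOrder_rhoA`, `transcendental_rhoA`); 09 = §C the cells `four_le_polarDeg_one_of_algUltra (hRoy)` (+ swap), the At-cells, the member cells at ρ_A, `rhoA_position`.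
PORT EDITS: the three `set_option linter.*` lines dropped and the one surfaced `unnecessarySimpa` fixed (`simpa using h12` ↦ `simp`, §R); 74 one-line docstrings added; two generic helpers made `private` (`three_mul_le_two_pow`, `half_identity`) with per-part private copies of those and of K's own private helpers; statements and proofs verbatim. `--supports stmt-Schanuel-24622`; no census credit carried; rung 0 — nothing here proves Schanuel.)
-/

noncomputable section

open Complex IntermediateField MvPolynomial

namespace Summit.Schanuel.Schanuel.Theorems.RootDecomp1BAlgFrame

open Summit.Schanuel.Schanuel.Theorems.RootDecomp1EPointTransfer (Roy2014_thm_1_1)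
open Summit.Schanuel.Schanuel.Theorems.RootDecomp1KHyper (mvlen mvlen_nonneg abs_coeff_le_mvlen one_le_mvlen)
open Summit.Schanuel.Schanuel.Theorems.RootDecomp1BHyperFrame (royDeg royS RoyNF roy_tree_iff framePt Ff
  Ff_eq_aeval exists_lipschitz_Ff linearIndependent_one_irrational)
open Summit.Schanuel.Schanuel.Theorems.RootDecomp1BQuadFrame (qy qe qpt qpt_apply framePt_qy_qe linearIndependent_qpt
  QuadHyperLiouville)
open Summit.Schanuel.Schanuel.Theorems.RootDecomp1BFedFlagCore (KleinIH polarDeg polarField)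
open Summit.Schanuel.Schanuel.Theorems.RootDecomp1BDefectFloorDefs (SharpRelativeLindemannAt TameDefectZeroAt
  WildSharpDefectZeroAt WildSharpDefectZeroInitAt WildSharpInitAt)
open Summit.Schanuel.Schanuel.Theorems.RootDecomp1BDefectFloorCells (natCast_le_trdeg_of_algebraicIndependent)
open Summit.Schanuel.Schanuel.Theorems.RootDecomp1BRadicalDescent (exists_int_relation)
open Summit.Schanuel.Schanuel.Theorems.RootDecomp1BMovingZero (mem_polarField_one mem_polarField_swap)

/-! ## §C  The cells: X(2) at (1 | ρ) and (ρ | 1), and the At-cells of items 32406 / 32407 / 32408 -/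

section Cells

/-- **THE CELL X(2) at `(1 | ρ)`, `ρ ∈ AlgUltraLiouville`, modulo Roy ONLY**: `4 ≤ polarDeg (1, ρ)`
(the four exponentials `e, e^ρ, e^i, e^{iρ}` of the polar field are algebraically independent). -/
theorem four_le_polarDeg_one_of_algUltra (hRoy : Roy2014_thm_1_1) {ρ : ℝ} (hρ : AlgUltraLiouville ρ) :
    ((2 + 2 : ℕ) : Cardinal) ≤ polarDeg ![(1 : ℝ), ρ] := by
  obtain ⟨_, he, hei, heρ, heρi⟩ := mem_polarField_one ρ
  have hai := algebraicIndependent_exp_qpt_of_algUltra hRoy hρ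
  refine natCast_le_trdeg_of_algebraicIndependent (L := polarField _) hai fun j => ?_
  simp only [qpt_apply]
  fin_cases j
  · simpa using he
  · simpa using heρ
  · simpa using hei
  · simpa using heρi

/-- The swapped cell X(2) at `(ρ | 1)`. -/
theorem four_le_polarDeg_swap_of_algUltra (hRoy : Roy2014_thm_1_1) {ρ : ℝ} (hρ : AlgUltraLiouville ρ) :
    ((2 + 2 : ℕ) : Cardinal) ≤ polarDeg ![ρ, (1 : ℝ)] := by
  obtain ⟨_, he, hei, heρ, heρi⟩ := mem_polarField_swap ρ
  have hai := algebraicIndependent_exp_qpt_of_algUltra hRoy hρ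
  refine natCast_le_trdeg_of_algebraicIndependent (L := polarField _) hai fun j => ?_
  simp only [qpt_apply]
  fin_cases j
  · simpa using he
  · simpa using heρ
  · simpa using hei
  · simpa using heρi

/-- X(1): `3 ≤ polarDeg (1, ρ)` (a fortiori; the floor used by the SRL step instance). -/
theorem three_le_polarDeg_one_of_algUltra (hRoy : Roy2014_thm_1_1) {ρ : ℝ} (hρ : AlgUltraLiouville ρ) :
    ((1 + 1 + 1 : ℕ) : Cardinal) ≤ polarDeg ![(1 : ℝ), ρ] :=
  (Nat.cast_le.2 (by norm_num)).trans (four_le_polarDeg_one_of_algUltra hRoy hρ)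

/-- The X(2) floor in the VERBATIM shape of the body of the 1B crux `KleinPolarSchanuel` (item 24622) at `m = 2`,
`r = (1, ρ)` (`polarDeg` unfolded), for `ρ ∈ AlgUltraLiouville`, mod Roy. -/
theorem kleinPolarSchanuel_body_two_one_algUltra (hRoy : Roy2014_thm_1_1) {ρ : ℝ} (hρ : AlgUltraLiouville ρ) :
    ((2 + 2 : ℕ) : Cardinal) ≤ Algebra.trdeg ℚ ↥(IntermediateField.adjoin ℚ
      (Set.range (Fin.append (fun j => ((![(1 : ℝ), ρ] j : ℝ) : ℂ)) (fun j => ((![(1 : ℝ), ρ] j : ℝ) : ℂ) * Complex.I)) ∪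
        Set.range (Complex.exp ∘ Fin.append (fun j => ((![(1 : ℝ), ρ] j : ℝ) : ℂ))
          (fun j => ((![(1 : ℝ), ρ] j : ℝ) : ℂ) * Complex.I)))) :=
  four_le_polarDeg_one_of_algUltra hRoy hρ

/-- Item 32406 At-shape: `SharpRelativeLindemannAt 1 (1, ρ)`. -/
theorem sharpRelativeLindemannAt_one_algUltra (hRoy : Roy2014_thm_1_1) {ρ : ℝ} (hρ : AlgUltraLiouville ρ) :
    SharpRelativeLindemannAt 1 ![(1 : ℝ), ρ] :=
  fun _ _ _ => three_le_polarDeg_one_of_algUltra hRoy hρ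

/-- Item 32407 At-shape: `TameDefectZeroAt 1 (1, ρ)`. -/
theorem tameDefectZeroAt_one_algUltra (hRoy : Roy2014_thm_1_1) {ρ : ℝ} (hρ : AlgUltraLiouville ρ) :
    TameDefectZeroAt 1 ![(1 : ℝ), ρ] :=
  fun _ _ _ _ => four_le_polarDeg_one_of_algUltra hRoy hρ

/-- Item 32408 At-shape: `WildSharpDefectZeroAt 1 (1, ρ)`. -/
theorem wildSharpDefectZeroAt_one_algUltra (hRoy : Roy2014_thm_1_1) {ρ : ℝ} (hρ : AlgUltraLiouville ρ) :
    WildSharpDefectZeroAt 1 ![(1 : ℝ), ρ] :=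
  fun _ _ _ _ _ => four_le_polarDeg_one_of_algUltra hRoy hρ

/-- Item 32408 At-shape (initial form): `WildSharpDefectZeroInitAt 1 (1, ρ)`. -/
theorem wildSharpDefectZeroInitAt_one_algUltra (hRoy : Roy2014_thm_1_1) {ρ : ℝ} (hρ : AlgUltraLiouville ρ) :
    WildSharpDefectZeroInitAt 1 ![(1 : ℝ), ρ] :=
  fun _ _ _ _ _ => four_le_polarDeg_one_of_algUltra hRoy hρ

/-! ### member cells: the same cells at the NAMED member `rhoA` (no class hypothesis left; mod `hRoy` only) -/

/-- `ρ_A` is irrational. -/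
theorem irrational_rhoA : Irrational rhoA := transcendental_rhoA.irrational

/-- `(1, ρ_A)` is ℚ-free (the hypothesis of the live 1B cruxes at the column `(1 | ρ_A)`; tree lemma
`RootDecomp1BHyperFrame.linearIndependent_one_irrational`). -/
theorem linearIndependent_one_rhoA : LinearIndependent ℚ (![(1 : ℝ), rhoA] : Fin 2 → ℝ) :=
  Summit.Schanuel.Schanuel.Theorems.RootDecomp1BHyperFrame.linearIndependent_one_irrational irrational_rhoA

/-- `(ρ_A, 1)` is ℚ-free too. -/
theorem linearIndependent_swap_rhoA : LinearIndependent ℚ (![rhoA, (1 : ℝ)] : Fin 2 → ℝ) := by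
  rw [LinearIndependent.pair_iff]
  intro s t h
  have h' : (s : ℝ) * rhoA + (t : ℝ) = 0 := by simpa [Rat.smul_def] using h
  by_cases hs : s = 0
  · subst hs
    have : (t : ℝ) = 0 := by simpa using h'
    exact ⟨rfl, by exact_mod_cast this⟩
  · exfalso
    apply irrational_rhoA
    refine ⟨-t / s, ?_⟩
    have hsr : (s : ℝ) ≠ 0 := by exact_mod_cast hs
    push_cast
    field_simp
    linarith

/-- **`e, e^{ρ_A}, e^i, e^{iρ_A}` are algebraically independent** (mod Roy). -/
theorem algebraicIndependent_rhoA (hRoy : Roy2014_thm_1_1) :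
    AlgebraicIndependent ℚ ![cexp 1, cexp rhoA, cexp I, cexp (rhoA * I)] :=
  algebraicIndependent_exp_frame_of_algUltraLiouville hRoy algUltraLiouville_rhoA

/-- X(2)(1, ρ_A), mod Roy. -/
theorem four_le_polarDeg_one_rhoA (hRoy : Roy2014_thm_1_1) :
    ((2 + 2 : ℕ) : Cardinal) ≤ polarDeg ![(1 : ℝ), rhoA] :=
  four_le_polarDeg_one_of_algUltra hRoy algUltraLiouville_rhoA

/-- X(2)(ρ_A, 1), mod Roy. -/
theorem four_le_polarDeg_swap_rhoA (hRoy : Roy2014_thm_1_1) :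
    ((2 + 2 : ℕ) : Cardinal) ≤ polarDeg ![rhoA, (1 : ℝ)] :=
  four_le_polarDeg_swap_of_algUltra hRoy algUltraLiouville_rhoA

/-- The Klein–polar X(2) body at `(1, ρ_A)` VERBATIM (`m = 2`, `r = ![1, ρ_A]`), mod Roy. -/
theorem kleinPolarSchanuel_body_two_one_rhoA (hRoy : Roy2014_thm_1_1) :
    ((2 + 2 : ℕ) : Cardinal) ≤ Algebra.trdeg ℚ ↥(IntermediateField.adjoin ℚ
      (Set.range (Fin.append (fun j => ((![(1 : ℝ), rhoA] j : ℝ) : ℂ)) (fun j => ((![(1 : ℝ), rhoA] j : ℝ) : ℂ) * Complex.I)) ∪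
        Set.range (Complex.exp ∘ Fin.append (fun j => ((![(1 : ℝ), rhoA] j : ℝ) : ℂ))
          (fun j => ((![(1 : ℝ), rhoA] j : ℝ) : ℂ) * Complex.I)))) :=
  four_le_polarDeg_one_rhoA hRoy

/-- `SharpRelativeLindemannAt 1` at `(1, ρ_A)`, mod Roy. -/
theorem sharpRelativeLindemannAt_one_rhoA (hRoy : Roy2014_thm_1_1) : SharpRelativeLindemannAt 1 ![(1 : ℝ), rhoA] :=
  sharpRelativeLindemannAt_one_algUltra hRoy algUltraLiouville_rhoA

/-- `TameDefectZeroAt 1` at `(1, ρ_A)`, mod Roy. -/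
theorem tameDefectZeroAt_one_rhoA (hRoy : Roy2014_thm_1_1) : TameDefectZeroAt 1 ![(1 : ℝ), rhoA] :=
  tameDefectZeroAt_one_algUltra hRoy algUltraLiouville_rhoA

/-- `WildSharpDefectZeroAt 1` at `(1, ρ_A)`, mod Roy. -/
theorem wildSharpDefectZeroAt_one_rhoA (hRoy : Roy2014_thm_1_1) : WildSharpDefectZeroAt 1 ![(1 : ℝ), rhoA] :=
  wildSharpDefectZeroAt_one_algUltra hRoy algUltraLiouville_rhoA

/-- `WildSharpDefectZeroInitAt 1` at `(1, ρ_A)`, mod Roy. -/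
theorem wildSharpDefectZeroInitAt_one_rhoA (hRoy : Roy2014_thm_1_1) :
    WildSharpDefectZeroInitAt 1 ![(1 : ℝ), rhoA] :=
  wildSharpDefectZeroInitAt_one_algUltra hRoy algUltraLiouville_rhoA

/-- **POSITION of `ρ_A`** (hypothesis-free): in the new class, in NONE of the earlier `(1|ρ)`-cell classes, and in no
bounded-degree hyper class. -/
theorem rhoA_position :
    AlgUltraLiouville rhoA ∧ Transcendental ℚ rhoA ∧
      ¬ Summit.Schanuel.Schanuel.Theorems.RootDecomp1KHyper.HyperCell.HyperLiouville rhoA ∧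
      ¬ QuadHyperLiouville rhoA ∧
      ¬ Summit.Schanuel.Schanuel.Theorems.RootDecomp1BRadicalDescent.UltraLiouville rhoA ∧
      ¬ Summit.Schanuel.Schanuel.Theorems.RootDecomp1EPointTransfer.UltraLiouville rhoA ∧
      ¬ Summit.Schanuel.Schanuel.Theorems.RootDecomp1KGeneric.LiouvilleOrder 8 rhoA ∧
      (∀ k, 4 ≤ k → ¬ Summit.Schanuel.Schanuel.Theorems.RootDecomp1KGeneric.LiouvilleOrder k rhoA) ∧
      (∀ d, ¬ DegHyperLiouville d rhoA) :=
  ⟨algUltraLiouville_rhoA, transcendental_rhoA, not_hyperLiouville_rhoA, not_quadHyperLiouville_rhoA,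
    not_ultraLiouville_rhoA, not_ultraLiouville_rhoA', not_liouvilleOrder_eight_rhoA,
    fun _ hk => not_liouvilleOrder_rhoA hk, not_degHyperLiouville_rhoA⟩

end Cells

end Summit.Schanuel.Schanuel.Theorems.RootDecomp1BAlgFrame

end
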